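import Summits.QuantumFields.YangMills.Theorems.FluctuationComparisonRegPrIntLSectionTubeSplit
import HarnessLib

/-!
# `FluctuationComparisonRegPrIntLPersistenceSigmaFree` — LINE g22-2∕g22-4, row PERS₁∘ `OneLevelPersistenceIntCan`: THE σ-FREE PATH — PERS₁∘ VERBATIM FROM ⟨UP⟩ + ⟨LOW⟩ +
# ⟨SMALL-MASS₁⟩, WITH NO SECTION AND NO TUBE (crux `UnitScaleTilt.FluctuationComparisonRegPrIntL`, stmt-QuantumFields-20520; sibling of ✓`…SectionTubeSplit` (400-line cap);
# observation of ym3-torus-px8 g14, 2026-08-30 06:36:55Z, confirmed by LEAD w3-20520 g18)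

Cell `ym3-torus` (YM ladder rung R3 = continuum SU(2) Yang–Mills on T³ — a RUNG, NOT the Clay problem: not d = 4, not infinite volume, not a mass gap);
width seat `ym-ust-20520-w3` (gen 18, LEAD-20520); helper `--supports stmt-QuantumFields-20520`.  THEOREMS ONLY (0 `def`, 0 `sorry`, default heartbeats).

WHY.  LINE g22-4 cut PERS₁∘ into GEOM∘ (a section `σ` with margin) + TUBE∘ (the tube around `σ` is charged); ✓`…SectionTubeSplit` cut TUBE∘ into ⟨UP⟩ + ⟨LOW⟩ + ⟨HAAR-TUBE₁⟩.
But PERS₁∘'s TARGET — «the run's level `J+1` lies in ITS interior window `W_{J+1}(c·b₀)`» — does not depend on the datum, so the one-level chain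
✓`sectionTube_setwise_of_up_low_haarTube` runs with the datum-INDEPENDENT target `T := S′ := {PlaqSmall θ_{J+1}(c·b₀)}`: no section, no tube, no measurable selection.
* ★★★`oneLevelPersistenceIntCan_of_up_low_smallMass : ⟨UP⟩ + ⟨LOW on S′⟩ + ⟨SMALL-MASS₁(S′)⟩ → PERS₁∘ VERBATIM` (`Lines/persistence_geometry.lean` 970dcf79 ll.93–101 =
  `Lines/persistence_floor.lean` §2), where ⟨SMALL-MASS₁(S′)⟩ := `∃ q₀ > 0, ∀ B ⊆ W_J(c·b₀) measurable, q₀·dU_{J+1}(D⁻¹B) ≤ dU_{J+1}(D⁻¹B ∩ S′)` — the K-FREE one-step Haar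
  kinematics (per-datum positivity = the window chart's `charge` fed by the W7 interior preimage ✓`interiorSection_pointwise`; uniformity = l.s.c. + compactness:
  px8 g14 (A1″) ∕ w4-20520 g18 `…HaarTubeLscFloor`).
HONEST SCOPE.  A door; ⟨UP⟩, ⟨LOW⟩ ([Balaban1985UV3] (7) at height `K−J−1`, K-UNIFORM, XL — nobody's hand) and ⟨SMALL-MASS₁⟩ are the HYPOTHESES, NOT proved; PERS₁∘, POS∘,
PLAQTAIL∘, LFR♯ᶜ∘, S2β, 20520, `YM3TorusSU2` NOT proved; the Yang–Mills mass gap is NOT proved.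
HYP-SAT (cell RULING №42).  `C, cl` after `F, γ, J`, before `K`; `q₀` after `F, γ, J`, before `B`; satisfiable on the literal T³ families modulo exactly (7) and
[Balaban1985Averaging] Prop. 1.
References: [Balaban1985UV3] (7) p. 257, (38)–(40) p. 266; [Balaban1987RG1] (0.18)–(0.22) p. 255; [Balaban1985Averaging] (10) p. 19, Prop. 1 p. 22.
-/

noncomputable section

set_option autoImplicit false

open MeasureTheory Filter Topology Set
open scoped ENNReal NNReal
open Literature.MathematicalPhysics.QuantumFieldTheory.Balaban1983to89
open Literature.MathematicalPhysics.QuantumFieldTheory.Balaban1983to89.T3ContinuumYM3Torus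
open Literature.MathematicalPhysics.QuantumFieldTheory.Balaban1983to89.T3NestedUnitLaws
open Literature.MathematicalPhysics.QuantumFieldTheory.Balaban1983to89.T3UnitLawDensityEML
open Literature.MathematicalPhysics.QuantumFieldTheory.Balaban1983to89.T3UnitScaleTilt
open Literature.MathematicalPhysics.QuantumFieldTheory.Balaban1983to89.T3TiltDescent
open Literature.MathematicalPhysics.QuantumFieldTheory.Balaban1983to89.T3DescentFibreTower
open Literature.MathematicalPhysics.QuantumFieldTheory.Balaban1983to89.Missing
open Summit.QuantumFields.YangMills.Theorems.FluctuationComparisonRegPrIntLSectionTubeSplit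

namespace Summit.QuantumFields.YangMills.Theorems.FluctuationComparisonRegPrIntLPersistenceSigmaFree

/-- ★★★ **PERS₁∘ `OneLevelPersistenceIntCan` VERBATIM ⟸ ⟨UP⟩ + ⟨LOW on the level-(J+1) interior window `S′`⟩ + ⟨SMALL-MASS₁(S′)⟩ — NO SECTION, NO TUBE** (ym3-torus-px8
g14's observation, 2026-08-30 06:36:55Z): PERS₁∘'s target `D_{J+1,K}⁻¹ S′`, `S′ := {PlaqSmall θ_{J+1}(c·b₀)}`, is independent of the datum, so ✓`…SectionTubeSplit`'s one-level chain
`sectionTube_setwise_of_up_low_haarTube` runs with `T := S′`: ⟨LOW⟩ `cl·dU_{J+1}⌊S′ ≤ ν_K⌊S′`, ⟨SMALL-MASS₁⟩ `q₀·dU_{J+1}(D⁻¹B) ≤ dU_{J+1}(D⁻¹B ∩ S′)` («over interior level-`J`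
data the one-step Haar fibre gives conditional mass `≥ q₀` to level-`(J+1)` interior fields» — K-FREE kinematics of `ℰp`: per-datum positivity = the window chart's `charge`
fed by the W7 interior preimage ✓`interiorSection_pointwise`, uniformity = l.s.c. + compactness), ⟨UP⟩ `ν_K⌊D⁻¹W_J(c·b₀) ≤ C·dU_{J+1}⌊D⁻¹W_J(c·b₀)` ⟹ `q := cl·q₀∕C`
(`ν_K := (Gibbs_K).map D_{J+1,K}`; tower identity lit ✓`descendTo_descendTo`).  So GEOM∘ ∕ KRN∘ ∕ TUBE∘ are OFF PERS₁∘'s critical path (they remain theorems∕rows in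
their own right).  HONEST SCOPE: a door; ⟨UP⟩, ⟨LOW⟩ ([Balaban1985UV3] (7), K-uniform, XL) and ⟨SMALL-MASS₁⟩ ([Balaban1985Averaging] Prop. 1, M) are the HYPOTHESES, NOT
proved; PERS₁∘, POS∘, LFR♯ᶜ∘, S2β, 20520 NOT proved. [cite: Balaban1985UV3, (7) p.257 and (38)-(40) p.266; Balaban1987RG1, (0.18)-(0.22) p.255; Balaban1985Averaging, Prop. 1 p.22] -/
theorem oneLevelPersistenceIntCan_of_up_low_smallMass
    (h : ∀ (L : ℕ), ∃ c₀ : ℝ, 0 < c₀ ∧ c₀ ≤ 1 ∧ ∀ (c : ℝ), 0 < c → c ≤ c₀ → ∃ pS : ℝ, ∀ (b₀ p₀ : ℝ), 0 < b₀ → pS ≤ p₀ → 0 < p₀ →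
      ∃ γ₁ : ℝ, 0 < γ₁ ∧ ∀ (F : T3Family) (γ : ℝ), F.L = L → 0 < γ → γ ≤ γ₁ →
        ∀ (J : ℕ),
          (∃ C cl : ℝ, 0 < C ∧ 0 < cl ∧ ∀ (K : ℕ) (hJK : J + 1 ≤ K),
            ((gibbsK F ℰp γ K).map (descendTo F ℰp (J + 1) K hJK)).restrict
                (descendTo F ℰp J (J + 1) (Nat.le_succ J) ⁻¹' {U | PlaqSmall (θBal F.L γ (c * b₀) p₀ J) U}) ≤
              ENNReal.ofReal C • (fieldMeasure (F.P (J + 1)) 0 (Matrix.specialUnitaryGroup (Fin 2) ℂ)).restrict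
                (descendTo F ℰp J (J + 1) (Nat.le_succ J) ⁻¹' {U | PlaqSmall (θBal F.L γ (c * b₀) p₀ J) U}) ∧
            ENNReal.ofReal cl • (fieldMeasure (F.P (J + 1)) 0 (Matrix.specialUnitaryGroup (Fin 2) ℂ)).restrict
                {V | PlaqSmall (θBal F.L γ (c * b₀) p₀ (J + 1)) V} ≤
              ((gibbsK F ℰp γ K).map (descendTo F ℰp (J + 1) K hJK)).restrict {V | PlaqSmall (θBal F.L γ (c * b₀) p₀ (J + 1)) V}) ∧
          (∃ q₀ : ℝ, 0 < q₀ ∧ ∀ (B : Set (GaugeField (F.P J) 0 (Matrix.specialUnitaryGroup (Fin 2) ℂ))), MeasurableSet B →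
            B ⊆ {U | PlaqSmall (θBal F.L γ (c * b₀) p₀ J) U} →
            ENNReal.ofReal q₀ * fieldMeasure (F.P (J + 1)) 0 (Matrix.specialUnitaryGroup (Fin 2) ℂ) (descendTo F ℰp J (J + 1) (Nat.le_succ J) ⁻¹' B) ≤
              fieldMeasure (F.P (J + 1)) 0 (Matrix.specialUnitaryGroup (Fin 2) ℂ) (descendTo F ℰp J (J + 1) (Nat.le_succ J) ⁻¹' B ∩
                {V | PlaqSmall (θBal F.L γ (c * b₀) p₀ (J + 1)) V}))) :
    ∀ (L : ℕ), ∃ c₀ : ℝ, 0 < c₀ ∧ c₀ ≤ 1 ∧ ∀ (c : ℝ), 0 < c → c ≤ c₀ → ∃ pS : ℝ, ∀ (b₀ p₀ : ℝ), 0 < b₀ → pS ≤ p₀ → 0 < p₀ →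
      ∃ γ₁ : ℝ, 0 < γ₁ ∧ ∀ (F : T3Family) (γ : ℝ), F.L = L → 0 < γ → γ ≤ γ₁ →
        ∀ (J : ℕ), ∃ q : ℝ, 0 < q ∧ ∀ (K : ℕ) (hJK : J + 1 ≤ K)
          (B : Set (GaugeField (F.P J) 0 (Matrix.specialUnitaryGroup (Fin 2) ℂ))), MeasurableSet B →
            B ⊆ {U | PlaqSmall (θBal F.L γ (c * b₀) p₀ J) U} →
            ENNReal.ofReal q * gibbsK F ℰp γ K (descendTo F ℰp J K ((Nat.le_succ J).trans hJK) ⁻¹' B) ≤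
              gibbsK F ℰp γ K (descendTo F ℰp J K ((Nat.le_succ J).trans hJK) ⁻¹' B ∩
                descendTo F ℰp (J + 1) K hJK ⁻¹' {V | PlaqSmall (θBal F.L γ (c * b₀) p₀ (J + 1)) V}) := by
  intro L
  obtain ⟨c₀, hc₀, hc₀1, hc⟩ := h L
  refine ⟨c₀, hc₀, hc₀1, fun c hcpos hcle => ?_⟩
  obtain ⟨pS, hpS⟩ := hc c hcpos hcle
  refine ⟨pS, fun b₀ p₀ hb₀ hpS' hp₀ => ?_⟩
  obtain ⟨γ₁, hγ₁, hγ₁F⟩ := hpS b₀ p₀ hb₀ hpS' hp₀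
  refine ⟨γ₁, hγ₁, fun F γ hFL hγ hγle J => ?_⟩
  obtain ⟨⟨C, cl, hC, hcl, hUL⟩, q₀, hq₀, hSM⟩ := hγ₁F F γ hFL hγ hγle J
  refine ⟨cl * q₀ / C, by positivity, fun K hJK B hB hBW => ?_⟩
  obtain ⟨hup, hlow⟩ := hUL K hJK
  -- measurability
  have hD : Measurable (descendTo F ℰp J (J + 1) (Nat.le_succ J)) := measurable_descendTo F ℰp measurableE_ℰp _
  have hD' : Measurable (descendTo F ℰp (J + 1) K hJK) := measurable_descendTo F ℰp measurableE_ℰp _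
  have hW : MeasurableSet {U : GaugeField (F.P J) 0 (Matrix.specialUnitaryGroup (Fin 2) ℂ) | PlaqSmall (θBal F.L γ (c * b₀) p₀ J) U} :=
    measurableSet_plaqSmall _
  have hS : MeasurableSet {V : GaugeField (F.P (J + 1)) 0 (Matrix.specialUnitaryGroup (Fin 2) ℂ) | PlaqSmall (θBal F.L γ (c * b₀) p₀ (J + 1)) V} :=
    measurableSet_plaqSmall _
  -- the one-level chain with the datum-independent target `T := S′`
  have hchain := sectionTube_setwise_of_up_low_haarTube ((gibbsK F ℰp γ K).map (descendTo F ℰp (J + 1) K hJK))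
    (fieldMeasure (F.P (J + 1)) 0 (Matrix.specialUnitaryGroup (Fin 2) ℂ)) (hD hW) hS (Set.preimage_mono hBW)
    (Set.inter_subset_right : descendTo F ℰp J (J + 1) (Nat.le_succ J) ⁻¹' B ∩
      {V : GaugeField (F.P (J + 1)) 0 (Matrix.specialUnitaryGroup (Fin 2) ℂ) | PlaqSmall (θBal F.L γ (c * b₀) p₀ (J + 1)) V} ⊆ _)
    hC hcl.le hq₀.le hup hlow (hSM B hB hBW)
  -- back to run `K` through the tower identity
  have hpre : descendTo F ℰp J K ((Nat.le_succ J).trans hJK) ⁻¹' B =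
      descendTo F ℰp (J + 1) K hJK ⁻¹' (descendTo F ℰp J (J + 1) (Nat.le_succ J) ⁻¹' B) := by
    ext V
    simp only [Set.mem_preimage, descendTo_descendTo]
  have hpreT : descendTo F ℰp J K ((Nat.le_succ J).trans hJK) ⁻¹' B ∩
      descendTo F ℰp (J + 1) K hJK ⁻¹' {V | PlaqSmall (θBal F.L γ (c * b₀) p₀ (J + 1)) V} =
      descendTo F ℰp (J + 1) K hJK ⁻¹' (descendTo F ℰp J (J + 1) (Nat.le_succ J) ⁻¹' B ∩
        {V | PlaqSmall (θBal F.L γ (c * b₀) p₀ (J + 1)) V}) := by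
    ext V
    simp only [Set.mem_inter_iff, Set.mem_preimage, Set.mem_setOf_eq, descendTo_descendTo]
  have e1 : gibbsK F ℰp γ K (descendTo F ℰp J K ((Nat.le_succ J).trans hJK) ⁻¹' B) =
      gibbsK F ℰp γ K (descendTo F ℰp (J + 1) K hJK ⁻¹' (descendTo F ℰp J (J + 1) (Nat.le_succ J) ⁻¹' B)) := congrArg _ hpre
  have e2 := congrArg (gibbsK F ℰp γ K) hpreT
  rw [e1, e2]
  rwa [Measure.map_apply hD' (hD hB), Measure.map_apply hD' ((hD hB).inter hS)] at hchain

end Summit.QuantumFields.YangMills.Theorems.FluctuationComparisonRegPrIntLPersistenceSigmaFree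

end
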